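import Mathlib
import Literature.AlgebraicGeometry.Resolution.LocalBlowup
import Literature.AlgebraicGeometry.Resolution.RegularLocalRingsNormal
import Summits.ResolutionOfSingularities.ResolutionOfSingularities.Theorems.FrobeniusClosingSteerMemberDimension
import Summits.ResolutionOfSingularities.ResolutionOfSingularities.Theorems.FrobeniusClosingSteerMembersPerfectResidue
import HarnessLib

/-!
# Crux `Steer` (stmt-ResolutionOfSingularities-16345), line `switching_dichotomy`, σ-residual HIGH half at `p = 2`:
# RUN HYGIENE (`RunHygieneTwo` of res-L0-w41-strat-2's §σ2.18, Theses-free body)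

OURS (campaign `res-hironaka`, rung L ★L-G4, slot W4.1, chain W4.1; seat `res-D-pv-028` g6 on the hygiene stub of
`L/res-L0-w41-strat-2/R2TwoSigma-s16-strat2.delta.lean` rev 8 (sha16 9b8bc57484cdc9e7, §σ2.18 `RunHygieneTwo`,
consumer `pointTailHighConclTwo_of_hygiene`); replaces the role of no printed item; NOT a statement of the manuscript under
review [claim: Hironaka2017, status: under-review]; AI review is weaker than expert review).

**The fact.** Along a σ_top-steered torsor run `(R i, P i, s i)` of a core datum `(O, A₀, t)` at `p = 2`, `n = 4`
(`R 0 = (A₀)_{𝔪_O ∩ A₀}`, every `R (i+1)` the local blowing up of `R i` along `P i` with respect to `O`,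
`s i = x · s (i+1) + g` with `x, g ∈ R i`, `x ≠ 0`), the six bookkeeping clauses of `RunHygieneTwo` hold:

1. `O ≠ K` — the core local ring `(A₀)_{𝔪_O ∩ A₀}` has Krull dimension `> 2`, so the centre `𝔪_O ∩ A₀` is not `⊥` and
   contains a non-zero element of positive value (`ne_top_of_not_ringKrullDim_le`);
2. every member is the local ring at the centre of `O` of a subring of `O` (itself: `IsLocalBlowup.locAtCentre_eq`);
3. every member has Krull dimension `4` (K-T1 `TailCodim.ringKrullDim_member_eq`, p503921);
4. residue constants are squares (`MembersPerfectResidue.perfectField_residueField_of_steps`, p503984, + Frobenius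
   surjective on a perfect residue field of characteristic `2`);
5. the generator `s j` is never a fraction of elements of `R j`: all members lie in the subfield `F = Frac (R 0)` of `K`
   (local blowing ups adjoin quotients), `s j ∈ F ⇒ s 0 = t ∈ F` along `s i = x s (i+1) + g`, and `t ∉ F` because
   `(A₀)_{𝔪_O ∩ A₀}` is regular, hence integrally closed (Matsumura Thm. 19.4, tree
   `isIntegrallyClosed_of_isRegularLocalRing`), while `t ^ 2` is not a square in it (the core datum's non-square row);
6. `K² ⊆ Frac (R j)`: `K = Frac (k[A₀, t])` and in characteristic `2` the square of every element of `k[A₀, t]` lies in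
   `A₀ ⊆ R j` (`t ^ 2 ∈ A₀`, Frobenius additive).

`runHygieneTwo_of_steeredRun` assembles them with the needed core-datum rows as separate hypotheses and the run
clauses unfolded (the blow-up clause and the strict-step clause of `IsSteeredRun`), so that the in-skeleton leaf
`runHygieneTwo_holds : RunHygieneTwo` is a destructuring `exact`.
[cite: NovacoskiSpivakovsky2014, Def. 2.8 and Def. 2.11] [cite: Matsumura1987, Thm. 19.4] [folklore]
-/

-- The namespace mirrors the chain's helper layout (`…Theorems.SwitchingDichotomy.<Piece>`) on purpose.
set_option linter.dupNamespace false

noncomputable section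

namespace Summit.ResolutionOfSingularities.ResolutionOfSingularities.Theorems.SwitchingDichotomy.RunHygiene

open IsLocalRing Literature.AlgebraicGeometry.Resolution

universe u

section Members

variable {K : Type u} [Field K]

/-! ## 1. Members of a tower of local blowings up stay inside any subfield containing the first member -/

/-- `B_{𝔪_O ∩ B}` lies in every subfield containing `B` (its elements are quotients of elements of `B`). [folklore] -/
theorem locAtCentre_le_subfield (B : Subring K) (O : ValuationSubring K) (F : Subfield K)
    (h : B ≤ F.toSubring) : locAtCentre B O ≤ F.toSubring := by
  rintro _ ⟨y, hy, z, hz, -, rfl⟩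
  exact F.div_mem (h hy) (h hz)

/-- A local blowing up along an ideal stays inside every subfield containing the source (the chart adjoins the
quotients `x / u₀` of generators). [cite: NovacoskiSpivakovsky2014, Def. 2.11] -/
theorem target_le_subfield {O : ValuationSubring K} {B B' : Subring K} {I : Ideal B}
    (H : IsLocalBlowupAlong O B I B') (F : Subfield K) (h : B ≤ F.toSubring) : B' ≤ F.toSubring := by
  obtain ⟨-, u, u₀, -, -, -, -, rfl⟩ := H
  refine locAtCentre_le_subfield _ O F (Subring.closure_le.mpr ?_)
  rintro x (hx | ⟨y, -, rfl⟩)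
  · exact h hx
  · exact F.div_mem (h y.2) (h u₀.2)

/-- Along a sequence of local blowings up, every member lies in any subfield containing `R 0`. [folklore] -/
theorem member_le_subfield (O : ValuationSubring K) (R : ℕ → Subring K) (P : (i : ℕ) → Ideal (R i))
    (hbl : ∀ i, IsLocalBlowupAlong O (R i) (P i) (R (i + 1))) (F : Subfield K) (h0 : R 0 ≤ F.toSubring) :
    ∀ j, R j ≤ F.toSubring := by
  intro j
  induction j with
  | zero => exact h0
  | succ j ih => exact target_le_subfield (hbl j) F ih

/-- **Transport of the generator along the strict-transform steps**: if every member lies in the subfield `F` and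
`s 0 ∉ F`, then `s j ∉ F` for every `j` (`s j = x · s (j+1) + g` with `x, g ∈ R j ⊆ F`, `x ≠ 0`). The strict-step clause
is the one of `IsSteeredRun` (`IsStrictStepAlong` unfolded). [folklore] -/
theorem generator_not_mem_subfield (O : ValuationSubring K) (R : ℕ → Subring K) (P : (i : ℕ) → Ideal (R i))
    (s : ℕ → K) (F : Subfield K) (hR : ∀ j, R j ≤ F.toSubring)
    (hst : ∀ i, ∃ x g : K, ((∃ hx : x ∈ R i, (⟨x, hx⟩ : R i) ∈ P i) ∧ x ≠ 0 ∧
      ∀ y : R i, y ∈ P i → O.valuation (y : K) ≤ O.valuation x) ∧ g ∈ R i ∧ s i = x * s (i + 1) + g)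
    (h0 : s 0 ∉ F) : ∀ j, s j ∉ F := by
  intro j
  induction j with
  | zero => exact h0
  | succ j ih =>
    intro hmem
    obtain ⟨x, g, ⟨⟨hx, -⟩, -, -⟩, hg, hs⟩ := hst j
    apply ih
    rw [hs]
    exact F.add_mem (F.mul_mem (hR j hx) hmem) (hR j hg)

/-- Hence, with the same data, `s j` is never a fraction `y / z` of elements of `R j`. [folklore] -/
theorem generator_mul_ne (O : ValuationSubring K) (R : ℕ → Subring K) (P : (i : ℕ) → Ideal (R i))
    (s : ℕ → K) (F : Subfield K) (hR : ∀ j, R j ≤ F.toSubring)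
    (hst : ∀ i, ∃ x g : K, ((∃ hx : x ∈ R i, (⟨x, hx⟩ : R i) ∈ P i) ∧ x ≠ 0 ∧
      ∀ y : R i, y ∈ P i → O.valuation (y : K) ≤ O.valuation x) ∧ g ∈ R i ∧ s i = x * s (i + 1) + g)
    (h0 : s 0 ∉ F) (j : ℕ) (y z : R j) (hz : (z : K) ≠ 0) : s j * z ≠ y := by
  intro h
  refine generator_not_mem_subfield O R P s F hR hst h0 j ?_
  have : s j = (y : K) / z := by rw [← h, mul_div_cancel_right₀ _ hz]
  rw [this]
  exact F.div_mem (hR j y.2) (hR j z.2)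

/-! ## 2. The radicand is not a square in the fraction field of the (regular) core local ring -/

/-- **`t ∉ Frac (B_{𝔪_O ∩ B})`** when `B_{𝔪_O ∩ B}` is regular and `t ^ 2 ∈ B` is not a square in it: a regular local
ring is integrally closed (Matsumura Thm. 19.4), so `(y/z)² = t² ∈ B_{𝔪_O ∩ B}` forces `y/z ∈ B_{𝔪_O ∩ B}`. The regularity
and non-square hypotheses are the core datum's rows, over `Localization.AtPrime (𝔪_O ∩ B)` (transport along
`locAtCentreEquiv`). [cite: Matsumura1987, Thm. 19.4] -/
theorem not_mem_closure_locAtCentre_of_not_sq {O : ValuationSubring K} {B : Subring K}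
    (h₀ : B ≤ O.toSubring) {t : K} (htp : t ^ 2 ∈ B)
    (hreg : IsRegularLocalRing (Localization.AtPrime
      (Ideal.comap (Subring.inclusion h₀) (IsLocalRing.maximalIdeal O))))
    (hc : ∀ c : Localization.AtPrime (Ideal.comap (Subring.inclusion h₀) (IsLocalRing.maximalIdeal O)),
      algebraMap B (Localization.AtPrime (Ideal.comap (Subring.inclusion h₀)
        (IsLocalRing.maximalIdeal O))) ⟨t ^ 2, htp⟩ ≠ c ^ 2) :
    t ∉ Subfield.closure ((locAtCentre B O : Subring K) : Set K) := by
  intro ht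
  haveI hLreg : IsRegularLocalRing (locAtCentre B O) := (isRegularLocalRing_locAtCentre_iff h₀).mpr hreg
  haveI : IsIntegrallyClosed (locAtCentre B O) := isIntegrallyClosed_of_isRegularLocalRing _
  -- the radicand as an element of `B_{𝔪_O ∩ B}`; it is not a square there
  have key : ∀ c : locAtCentre B O, algebraMap B (locAtCentre B O) ⟨t ^ 2, htp⟩ ≠ c ^ 2 := by
    intro c hfc
    apply hc ((locAtCentreEquiv h₀).symm c)
    have h := congrArg (locAtCentreEquiv h₀).symm hfc
    rw [map_pow, AlgEquiv.commutes] at h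
    exact h
  have hfK : ((algebraMap B (locAtCentre B O) ⟨t ^ 2, htp⟩ : locAtCentre B O) : K) = t ^ 2 := rfl
  rw [Subfield.mem_closure_iff] at ht
  obtain ⟨y, hy, z, hz, hyz⟩ := ht
  rw [Subring.closure_eq] at hy hz
  by_cases hz0 : z = 0
  · -- `t = y / 0 = 0`, and `0 = 0 ^ 2`
    have ht0 : t = 0 := by rw [← hyz, hz0, div_zero]
    refine key 0 (Subtype.ext ?_)
    rw [hfK, ht0]
    simp
  · have hyz' : y = t * z := by rw [← hyz, div_mul_cancel₀ _ hz0]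
    have hZ0 : (⟨z, hz⟩ : locAtCentre B O) ≠ 0 := fun h => hz0 (congrArg Subtype.val h)
    have hYZ : (⟨y, hy⟩ : locAtCentre B O) ^ 2 =
        (⟨z, hz⟩ : locAtCentre B O) ^ 2 * algebraMap B (locAtCentre B O) ⟨t ^ 2, htp⟩ := by
      apply Subtype.ext
      change y ^ 2 = z ^ 2 * t ^ 2
      rw [hyz']; ring
    obtain ⟨c, hc'⟩ := (IsIntegrallyClosed.pow_dvd_pow_iff two_ne_zero).mp ⟨_, hYZ⟩
    refine key c (mul_left_cancel₀ (pow_ne_zero 2 hZ0) ?_)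
    rw [← hYZ, hc']
    ring

/-! ## 3. `O ≠ K` from the dimension of the core local ring -/

/-- **`O ≠ K`** when the local ring of `B ⊆ O` at the centre of `O` has Krull dimension `> 2` (any positive dimension
would do): otherwise every non-zero element of `B` is a unit of `O`, the centre `𝔪_O ∩ B` is `⊥`, and the local ring at
it is a field. [folklore] -/
theorem ne_top_of_not_ringKrullDim_le {O : ValuationSubring K} {B : Subring K} (h₀ : B ≤ O.toSubring)
    (hdim : ¬ ringKrullDim (Localization.AtPrime
      (Ideal.comap (Subring.inclusion h₀) (IsLocalRing.maximalIdeal O))) ≤ 2) : O ≠ ⊤ := by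
  intro hO
  apply hdim
  have hbot : Ideal.comap (Subring.inclusion h₀) (IsLocalRing.maximalIdeal O) = ⊥ := by
    refine (Submodule.eq_bot_iff _).mpr fun a ha => ?_
    by_contra ha0
    rw [Ideal.mem_comap, ValuationSubring.valuation_lt_one_iff] at ha
    have ha0' : ((a : B) : K) ≠ 0 := fun h => ha0 (Subtype.ext h)
    -- a non-zero element of positive value has its inverse outside `O`
    have hinv : O.valuation ((a : B) : K)⁻¹ ≤ 1 :=
      (O.valuation_le_one_iff _).mpr (by rw [hO]; exact ValuationSubring.mem_top _)
    have h1 : O.valuation ((a : B) : K) * O.valuation ((a : B) : K)⁻¹ = 1 := by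
      rw [← map_mul, mul_inv_cancel₀ ha0', map_one]
    have hlt : O.valuation ((a : B) : K) * O.valuation ((a : B) : K)⁻¹ < 1 * 1 :=
      mul_lt_mul_of_lt_of_le_of_nonneg_of_pos ha hinv zero_le zero_lt_one
    rw [h1, one_mul] at hlt
    exact lt_irrefl _ hlt
  have hh : (Ideal.comap (Subring.inclusion h₀) (IsLocalRing.maximalIdeal O)).height = 0 := by
    rw [hbot]; exact Ideal.height_bot
  rw [IsLocalization.AtPrime.ringKrullDim_eq_height
    (Ideal.comap (Subring.inclusion h₀) (IsLocalRing.maximalIdeal O))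
    (Localization.AtPrime (Ideal.comap (Subring.inclusion h₀) (IsLocalRing.maximalIdeal O))), hh]
  simp

/-! ## 4. Residue constants are squares -/

/-- In a local subring of a field of characteristic `2` with PERFECT residue field every element is a square modulo the
maximal ideal. [folklore] -/
theorem exists_sub_sq_mem_maximalIdeal [CharP K 2] (S : Subring K) [IsLocalRing S]
    [PerfectField (ResidueField S)] (a : S) : ∃ b : S, a - b ^ 2 ∈ maximalIdeal S := by
  obtain ⟨b', hb'⟩ := ClosedPointDictionary.exists_pow_eq_residue_of_perfectField 2 (residue S a)
  obtain ⟨b, rfl⟩ := IsLocalRing.residue_surjective b'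
  refine ⟨b, ?_⟩
  rw [← Ideal.Quotient.eq]
  change residue S a = residue S (b ^ 2)
  rw [map_pow, hb']

end Members

/-! ## 5. `K² ⊆ A₀` -/

section Squares

variable {k K : Type u} [Field k] [Field K] [Algebra k K]

/-- In characteristic `2`, the square of every element of `k[A₀, t]` lies in `A₀` when `t ^ 2 ∈ A₀`. [folklore] -/
theorem sq_mem_of_mem_adjoin [CharP K 2] (A₀ : Subalgebra k K) (t : K) (htp : t ^ 2 ∈ A₀) {u : K}
    (hu : u ∈ Algebra.adjoin k (insert t (A₀ : Set K))) : u ^ 2 ∈ A₀ := by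
  induction hu using Algebra.adjoin_induction with
  | mem x hx =>
    rcases hx with rfl | hx
    · exact htp
    · exact A₀.pow_mem hx 2
  | algebraMap r => rw [← map_pow]; exact A₀.algebraMap_mem _
  | add x y _ _ hx hy => rw [add_pow_char]; exact A₀.add_mem hx hy
  | mul x y _ _ hx hy => rw [mul_pow]; exact A₀.mul_mem hx hy

/-- **`K² ⊆ Frac S`** for every subring `S ⊇ A₀` when `K = Frac (k[A₀, t])`, `t ^ 2 ∈ A₀`, characteristic `2`: for
`z ≠ 0` there are non-zero `a, b ∈ S` with `z² · b = a`. [folklore] -/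
theorem exists_sq_mul_eq [CharP K 2] (A₀ : Subalgebra k K) (t : K) (htp : t ^ 2 ∈ A₀)
    (hfr : IsFractionRing (Algebra.adjoin k (insert t (A₀ : Set K))) K)
    (S : Subring K) (hS : A₀.toSubring ≤ S) (z : K) (hz : z ≠ 0) :
    ∃ a b : S, (a : K) ≠ 0 ∧ (b : K) ≠ 0 ∧ z ^ 2 * (b : K) = a := by
  obtain ⟨x, y, hy, hxy⟩ := IsFractionRing.div_surjective (A := Algebra.adjoin k (insert t (A₀ : Set K))) z
  have hy0 : (y : K) ≠ 0 := by
    have := nonZeroDivisors.ne_zero hy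
    exact fun h => this (Subtype.ext h)
  have hxy' : (x : K) / y = z := hxy
  have hx0 : (x : K) ≠ 0 := by
    rintro h
    rw [h, zero_div] at hxy'
    exact hz hxy'.symm
  refine ⟨⟨(x : K) ^ 2, hS (sq_mem_of_mem_adjoin A₀ t htp x.2)⟩,
    ⟨(y : K) ^ 2, hS (sq_mem_of_mem_adjoin A₀ t htp y.2)⟩, pow_ne_zero 2 hx0, pow_ne_zero 2 hy0, ?_⟩
  change z ^ 2 * (y : K) ^ 2 = (x : K) ^ 2
  rw [← hxy', div_pow, div_mul_cancel₀ _ (pow_ne_zero 2 hy0)]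

end Squares

/-! ## 6. Assembly: `RunHygieneTwo`, Theses-free body -/

section Assembly

/-- **Run hygiene at `p = 2`** (`RunHygieneTwo` of §σ2.18 with the core-datum rows it needs as separate hypotheses and
the run clauses of `IsSteeredRun` unfolded: `hbl` = the local-blowing-up clause, `hst` = the strict-step clause with
`IsExcParamAlong` unfolded). For the skeleton leaf: destructure `core : CoreDatum 2 4 k K O A₀ h₀ t` into
`⟨hfg, htp, hfr, hreg, -, h0, hdim, -, -, -, -, hc, htr, -⟩` and pass `fun i => (hrun.2 i).2.2.1` /
`fun i => (hrun.2 i).2.2.2`. OURS. [cite: NovacoskiSpivakovsky2014, Def. 2.8 and Def. 2.11]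
[cite: Matsumura1987, Thm. 19.4] [folklore] -/
theorem runHygieneTwo_of_steeredRun {k K : Type} [Field k] [CharP k 2] [PerfectField k] [Field K] [Algebra k K]
    (O : ValuationSubring K) (A₀ : Subalgebra k K) (h₀ : A₀.toSubring ≤ O.toSubring) (t : K)
    (hfg : A₀.FG) (htp : t ^ 2 ∈ A₀)
    (hfr : IsFractionRing (Algebra.adjoin k (insert t (A₀ : Set K))) K)
    (hreg : IsRegularLocalRing (Localization.AtPrime
      (Ideal.comap (Subring.inclusion h₀) (IsLocalRing.maximalIdeal O))))
    (h0 : ∀ x ∈ O, ∃ f : Polynomial k, f ≠ 0 ∧ Polynomial.aeval x f ∈ O.nonunits)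
    (hdim : ¬ ringKrullDim (Localization.AtPrime
      (Ideal.comap (Subring.inclusion h₀) (IsLocalRing.maximalIdeal O))) ≤ 2)
    (hc : ∀ c : Localization.AtPrime (Ideal.comap (Subring.inclusion h₀) (IsLocalRing.maximalIdeal O)),
      algebraMap A₀.toSubring (Localization.AtPrime (Ideal.comap (Subring.inclusion h₀)
        (IsLocalRing.maximalIdeal O))) ⟨t ^ 2, htp⟩ ≠ c ^ 2)
    (htr : Algebra.trdeg k K = (4 : Cardinal))
    (R : ℕ → Subring K) (P : (i : ℕ) → Ideal (R i)) (s : ℕ → K)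
    (hR0 : R 0 = locAtCentre A₀.toSubring O)
    (hbl : ∀ i, IsLocalBlowupAlong O (R i) (P i) (R (i + 1)))
    (hst : ∀ i, ∃ x g : K, ((∃ hx : x ∈ R i, (⟨x, hx⟩ : R i) ∈ P i) ∧ x ≠ 0 ∧
      ∀ y : R i, y ∈ P i → O.valuation (y : K) ≤ O.valuation x) ∧ g ∈ R i ∧ s i = x * s (i + 1) + g)
    (hs0 : s 0 = t) :
    O ≠ ⊤ ∧ (∀ j, ∃ B : Subring K, B ≤ O.toSubring ∧ R j = locAtCentre B O) ∧
      (∀ j, ringKrullDim (R j) = 4) ∧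
      (∀ j, ∀ (_ : IsLocalRing (R j)) (a : R j), ∃ b : R j, a - b ^ 2 ∈ IsLocalRing.maximalIdeal (R j)) ∧
      (∀ j, ∀ y z : R j, (z : K) ≠ 0 → s j * z ≠ y) ∧
      (∀ j, ∀ z : K, z ≠ 0 → ∃ a b : R j, (a : K) ≠ 0 ∧ (b : K) ≠ 0 ∧ z ^ 2 * (b : K) = a) := by
  haveI : CharP K 2 := charP_of_injective_algebraMap (algebraMap k K).injective 2
  -- members contain `A₀` and lie in `O`
  have hmem : ∀ j, A₀.toSubring ≤ R j ∧ R j ≤ O.toSubring := fun j =>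
    MembersPerfectResidue.le_member_of_steps O A₀ h₀ R P j hR0 (fun i _ => hbl i) j le_rfl
  refine ⟨ne_top_of_not_ringKrullDim_le h₀ hdim, fun j => ?_, fun j => ?_, fun j hL a => ?_, fun j => ?_,
    fun j z hz => ?_⟩
  · -- (2) members are local rings at the centre of subrings of `O`
    rcases j with _ | j
    · exact ⟨A₀.toSubring, h₀, hR0⟩
    · exact ⟨R (j + 1), (hmem (j + 1)).2, ((hbl j).isLocalBlowup.locAtCentre_eq).symm⟩
  · -- (3) Krull dimension 4 (K-T1)
    exact TailCodim.ringKrullDim_member_eq k K O A₀ h₀ t two_pos hfg htp hfr h0 htr R j hR0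
      (fun i _ => (hbl i).isLocalBlowup)
  · -- (4) residues are squares
    haveI := hL
    haveI : PerfectField (ResidueField (R j)) :=
      MembersPerfectResidue.perfectField_residueField_of_steps O A₀ h₀ h0 R P j hR0 (fun i _ => hbl i)
    exact exists_sub_sq_mem_maximalIdeal (R j) a
  · -- (5) the generator is not a fraction of the member
    have hF0 : R 0 ≤ (Subfield.closure ((locAtCentre A₀.toSubring O : Subring K) : Set K)).toSubring := by
      rw [hR0]; exact fun x hx => Subfield.subset_closure hx
    have hR := member_le_subfield O R P hbl _ hF0
    have ht : s 0 ∉ Subfield.closure ((locAtCentre A₀.toSubring O : Subring K) : Set K) := by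
      rw [hs0]; exact not_mem_closure_locAtCentre_of_not_sq h₀ htp hreg hc
    exact generator_mul_ne O R P s _ hR hst ht j
  · -- (6) `K² ⊆ Frac (R j)`
    exact exists_sq_mul_eq A₀ t htp hfr (R j) (hmem j).1 z hz

end Assembly

end Summit.ResolutionOfSingularities.ResolutionOfSingularities.Theorems.SwitchingDichotomy.RunHygiene

end
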